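import Summits.AtomisticToContinuum.FouriersLaw.Theorems.BondHeatUncertaintyExtensiveSnapshotIrreversibilityEnergyWindowExcessSeam

/-!
# Crux `ExtensiveSnapshotIrreversibility` (stmt-AtomisticToContinuum-9121), fixed-`N` half `K_fix`:
the UNIFORM-INTEGRABILITY SEAM along a family of flipped tilts, both directions
(node «UniformIntegrabilityLadder», 2/4)

(helper file, theorem-side; decomp-a2c lens-1 «grading / quantitative ladder», generation 90.)

Along a family of normalised tilts `μ_δ = μ₀ · e^{φ_δ}` of a flip-invariant probability measure
`μ₀` (`δ → 0`, `δ ≠ 0`), `ψ_δ := φ_δ − φ_δ∘Θ`, write `KL_δ = KL(μ_δ ‖ Θ_*μ_δ)`,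
`Δ_δ = ∫ (e^{φ_δ} − e^{φ_δ∘Θ})²/(e^{φ_δ} + e^{φ_δ∘Θ}) dμ₀` and the level-set tail
`T_δ(η) = ∫_{|ψ_δ|>η} |ψ_δ| dμ_δ`.  The tail atom is graded by the SCALE `δ²`:

  (UI)  for every level `η > 0` and every `ε > 0`: `T_δ(η) ≤ ε δ²` eventually
        ("the odd log-ratio is uniformly integrable at scale `δ²`").

* ★ `klDiv_flip_le_of_uniformlyIntegrable` — SUFFICIENCY: (UI) and `Δ_δ ≤ D' δ²` eventually for
  every `D' > D` give `KL_δ ≤ K δ²` eventually for every `K > D` (generation 89's one-state split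
  `KL ≤ (1 + η/2) Δ + T(η)`, `toReal_klDiv_flip_tilted_le_triangular`, with `η` and `ε` chosen from
  the gap `K − D`);
* ★ `uniformlyIntegrable_of_klDiv_flip_le` — NECESSITY: `KL_δ ≤ K δ²` eventually for every
  `K > K₀ ≥ 0` together with the matching LOWER bound `K δ² ≤ Δ_δ` eventually for every `K < K₀`
  give (UI) (the excess `KL_δ − Δ_δ ≤ 2θ δ²` controls the tail,
  `mul_setIntegral_abs_mul_exp_le_toReal_klDiv_sub`; `KL < ∞` already gives `ψ_δ ∈ L¹(μ_δ)`,
  `Negative.klDiv_flip_tilted_ne_top_iff`); one state at a time: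
  `setIntegral_abs_mul_exp_le_of_klDiv_le` (used for the NESS necessity, where the bound must hold
  for EVERY representing exponent `φ`).

For the NESS family the matching lower bound is a THEOREM of the item's own linear-response
hypothesis (`…EnergyWindowTriangularLower`), so (UI) is necessary for `K_fix` outright
(`…EnergyWindowExcessAtoms`).  No new objects. [folklore]
-/

noncomputable section

namespace Summit.AtomisticToContinuum.FouriersLaw.Theorems.ExtensiveSnapshotIrreversibility.EnergyWindow

open MeasureTheory Filter Topology InformationTheory Real
open scoped ENNReal NNReal
open Literature.MathematicalPhysics.KineticTheory.HeatConduction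
open Summit.AtomisticToContinuum.FouriersLaw.Theorems.ExtensiveSnapshotIrreversibility.Negative
open Summit.AtomisticToContinuum.FouriersLaw.Theorems.ExtensiveSnapshotIrreversibility.ClausiusBudget.OddLogDensity

variable {N : ℕ}

section Seam

variable (μ₀ : Measure (PhaseSpace N)) [IsProbabilityMeasure μ₀]

/-- ★ **SUFFICIENCY (filter form): uniform integrability at scale `δ²` + `ΔSharp` ⟹ `KL ≤ K δ²`.**
For a family of tilts `μ_δ = μ₀ · e^{φ_δ}` (`∫ e^{φ_δ} dμ₀ = 1` eventually in `δ ≠ 0`) of a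
flip-invariant probability measure, `ψ_δ := φ_δ − φ_δ∘Θ`:
(UI) for every `η > 0`, `ε > 0`: `|ψ_δ| e^{φ_δ} ∈ L¹(μ₀)` and
`∫_{|ψ_δ|>η} |ψ_δ| e^{φ_δ} dμ₀ ≤ ε δ²` eventually;
(ΔSharp) `∫ (e^{φ_δ} − e^{φ_δ∘Θ})²/(e^{φ_δ} + e^{φ_δ∘Θ}) dμ₀ ≤ D' δ²` eventually for every `D' > D`
— imply `KL(μ_δ ‖ Θ_*μ_δ) ≤ K δ²` eventually for every `K > D` (`D' = (K + D)/2`,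
`η = (K − D')/(D' + 1)`, `ε = (K − D')/2`).  No moment, no concentration rate. [folklore] -/
theorem klDiv_flip_le_of_uniformlyIntegrable
    (hinv : μ₀.map (fun x : PhaseSpace N => (x.1, -x.2)) = μ₀) {D : ℝ}
    (φ : ℝ → PhaseSpace N → ℝ) (hφm : ∀ δ, Measurable (φ δ))
    (hZ : ∀ᶠ δ in 𝓝[≠] (0 : ℝ), Integrable (fun x => exp (φ δ x)) μ₀ ∧ ∫ x, exp (φ δ x) ∂μ₀ = 1)
    (hUI : ∀ η : ℝ, 0 < η → ∀ ε : ℝ, 0 < ε → ∀ᶠ δ in 𝓝[≠] (0 : ℝ),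
      Integrable (fun x => |φ δ x - φ δ (x.1, -x.2)| * exp (φ δ x)) μ₀ ∧
      ∫ x in {x | η < |φ δ x - φ δ (x.1, -x.2)|}, |φ δ x - φ δ (x.1, -x.2)| * exp (φ δ x) ∂μ₀ ≤
        ε * δ ^ 2)
    (hΔ : ∀ D' : ℝ, D < D' → ∀ᶠ δ in 𝓝[≠] (0 : ℝ),
      ∫ x, (exp (φ δ x) - exp (φ δ (x.1, -x.2))) ^ 2 / (exp (φ δ x) + exp (φ δ (x.1, -x.2))) ∂μ₀ ≤
        D' * δ ^ 2) :
    ∀ K : ℝ, D < K → ∀ᶠ δ in 𝓝[≠] (0 : ℝ),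
      klDiv (μ₀.tilted (φ δ)) ((μ₀.tilted (φ δ)).map (fun x : PhaseSpace N => (x.1, -x.2))) ≤
        ENNReal.ofReal (K * δ ^ 2) := by
  intro K hK
  by_cases hD : 0 ≤ D
  swap
  · -- `D < 0`: (ΔSharp) at `D' = D/2 < 0` is eventually absurd
    have hD2 : D < D / 2 := by linarith
    filter_upwards [hΔ (D / 2) hD2, self_mem_nhdsWithin] with δ hδ hne
    exfalso
    have h0 : 0 ≤ ∫ x, (exp (φ δ x) - exp (φ δ (x.1, -x.2))) ^ 2 /
        (exp (φ δ x) + exp (φ δ (x.1, -x.2))) ∂μ₀ := integral_nonneg fun x => triangular_nonneg _ _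
    have hδ2 : 0 < δ ^ 2 := by
      rw [← sq_abs]
      exact pow_pos (abs_pos.2 hne) 2
    nlinarith
  set D' : ℝ := (K + D) / 2 with hD'
  have hDD' : D < D' := by rw [hD']; linarith
  have hD'0 : 0 ≤ D' := by rw [hD']; linarith
  have hgap : 0 < K - D' := by rw [hD']; linarith
  set η : ℝ := (K - D') / (D' + 1) with hη
  have hη0 : 0 < η := by rw [hη]; positivity
  have hηD : (1 + η / 2) * D' ≤ D' + (K - D') / 2 := by
    have h1 : D' / (D' + 1) ≤ 1 := by rw [div_le_one (by linarith)]; linarith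
    have e : (1 + η / 2) * D' = D' + (K - D') / 2 * (D' / (D' + 1)) := by
      rw [hη]
      field_simp
    rw [e]
    nlinarith [mul_le_mul_of_nonneg_left h1 (by linarith : 0 ≤ (K - D') / 2)]
  filter_upwards [hZ, hUI η hη0 ((K - D') / 2) (by linarith), hΔ D' hDD'] with δ hZδ hUδ hΔδ
  obtain ⟨hfin, hmain⟩ :=
    toReal_klDiv_flip_tilted_le_triangular μ₀ hinv (hφm δ) hZδ.1 hZδ.2 hη0 hUδ.1
  rw [← ENNReal.ofReal_toReal hfin]
  refine ENNReal.ofReal_le_ofReal ?_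
  have hbulk : (1 + η / 2) * ∫ x, (exp (φ δ x) - exp (φ δ (x.1, -x.2))) ^ 2 /
      (exp (φ δ x) + exp (φ δ (x.1, -x.2))) ∂μ₀ ≤ (D' + (K - D') / 2) * δ ^ 2 :=
    calc (1 + η / 2) * ∫ x, (exp (φ δ x) - exp (φ δ (x.1, -x.2))) ^ 2 /
          (exp (φ δ x) + exp (φ δ (x.1, -x.2))) ∂μ₀ ≤ (1 + η / 2) * (D' * δ ^ 2) :=
          mul_le_mul_of_nonneg_left hΔδ (by positivity)
      _ = (1 + η / 2) * D' * δ ^ 2 := by ring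
      _ ≤ (D' + (K - D') / 2) * δ ^ 2 := mul_le_mul_of_nonneg_right hηD (sq_nonneg δ)
  nlinarith [hmain, hUδ.2, hbulk]

/-- **NECESSITY, one state.**  For a normalised tilt `μ₀ · e^{φ}` of a flip-invariant probability
measure, a level `η > 0`, `ε > 0`, `K₀ ≥ 0`, a scale `s ≥ 0` and `θ = excessSlope η · ε`: if
`KL(μ₀·e^{φ} ‖ Θ_*(μ₀·e^{φ})) ≤ (K₀ + θ) s` and
`(K₀ − θ) s ≤ Δ = ∫ (e^{φ} − e^{φ∘Θ})²/(e^{φ} + e^{φ∘Θ})`,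
then `|ψ| e^{φ} ∈ L¹(μ₀)` (`KL < ∞`, `Negative.klDiv_flip_tilted_ne_top_iff`) and
`∫_{|ψ|>η} |ψ| e^{φ} dμ₀ ≤ ε s` (`2 · excessSlope η · tail ≤ KL − Δ ≤ 2θ s`,
`mul_setIntegral_abs_mul_exp_le_toReal_klDiv_sub`). [folklore] -/
theorem setIntegral_abs_mul_exp_le_of_klDiv_le
    (hinv : μ₀.map (fun x : PhaseSpace N => (x.1, -x.2)) = μ₀) {φ : PhaseSpace N → ℝ}
    (hφm : Measurable φ) (hexp : Integrable (fun x => exp (φ x)) μ₀)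
    (hZ1 : ∫ x, exp (φ x) ∂μ₀ = 1) {η ε K₀ s : ℝ} (hη : 0 < η) (hε : 0 < ε) (hK₀ : 0 ≤ K₀)
    (hs : 0 ≤ s)
    (hKL : klDiv (μ₀.tilted φ) ((μ₀.tilted φ).map (fun x : PhaseSpace N => (x.1, -x.2))) ≤
      ENNReal.ofReal ((K₀ + excessSlope η * ε) * s))
    (hΔ : (K₀ - excessSlope η * ε) * s ≤
      ∫ x, (exp (φ x) - exp (φ (x.1, -x.2))) ^ 2 / (exp (φ x) + exp (φ (x.1, -x.2))) ∂μ₀) :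
    Integrable (fun x => |φ x - φ (x.1, -x.2)| * exp (φ x)) μ₀ ∧
      ∫ x in {x | η < |φ x - φ (x.1, -x.2)|}, |φ x - φ (x.1, -x.2)| * exp (φ x) ∂μ₀ ≤ ε * s := by
  have hc : 0 < excessSlope η := excessSlope_pos hη
  have hfin : klDiv (μ₀.tilted φ) ((μ₀.tilted φ).map (fun x : PhaseSpace N => (x.1, -x.2))) ≠ ∞ :=
    ne_top_of_le_ne_top ENNReal.ofReal_ne_top hKL
  -- `KL < ∞` gives `ψ ∈ L¹(μ₀·e^{φ})`, i.e. `|ψ| e^{φ} ∈ L¹(μ₀)`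
  have hψL1 : Integrable (fun x => φ x - φ (x.1, -x.2)) (μ₀.tilted φ) :=
    (klDiv_flip_tilted_ne_top_iff hinv hφm hexp).1 hfin
  have hw : Integrable (fun x => (φ x - φ (x.1, -x.2)) * exp (φ x)) μ₀ := by
    rw [integrable_tilted_iff hexp] at hψL1
    refine hψL1.congr (ae_of_all _ fun x => ?_)
    simp only [smul_eq_mul]
    ring
  have h1 : Integrable (fun x => |φ x - φ (x.1, -x.2)| * exp (φ x)) μ₀ := by
    refine hw.abs.congr (ae_of_all _ fun x => ?_)
    simp only [abs_mul, abs_of_pos (exp_pos _)]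
  refine ⟨h1, ?_⟩
  have hlow := mul_setIntegral_abs_mul_exp_le_toReal_klDiv_sub μ₀ hinv hφm hexp hZ1 hη h1
  have hKL' : (klDiv (μ₀.tilted φ) ((μ₀.tilted φ).map
      (fun x : PhaseSpace N => (x.1, -x.2)))).toReal ≤ (K₀ + excessSlope η * ε) * s :=
    (ENNReal.toReal_mono ENNReal.ofReal_ne_top hKL).trans
      (ENNReal.toReal_ofReal (by positivity)).le
  have h2 : 2 * excessSlope η * ∫ x in {x | η < |φ x - φ (x.1, -x.2)|},
      |φ x - φ (x.1, -x.2)| * exp (φ x) ∂μ₀ ≤ 2 * excessSlope η * (ε * s) := by linarith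
  exact le_of_mul_le_mul_left h2 (by positivity)

/-- ★ **NECESSITY (filter form): `KL ≤ K δ²` with the matching lower bound on `Δ` ⟹ uniform
integrability at scale `δ²`.**  For a family of tilts `μ_δ = μ₀ · e^{φ_δ}` (`∫ e^{φ_δ} dμ₀ = 1`
eventually) of a flip-invariant probability measure and a constant `K₀ ≥ 0`: if
`KL(μ_δ ‖ Θ_*μ_δ) ≤ K δ²` eventually for every `K > K₀` and
`K δ² ≤ ∫ (e^{φ_δ} − e^{φ_δ∘Θ})²/(e^{φ_δ} + e^{φ_δ∘Θ}) dμ₀` eventually for every `K < K₀`, then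
for every `η > 0`, `ε > 0`, eventually `|ψ_δ| e^{φ_δ} ∈ L¹(μ₀)` and
`∫_{|ψ_δ|>η} |ψ_δ| e^{φ_δ} dμ₀ ≤ ε δ²` (`setIntegral_abs_mul_exp_le_of_klDiv_le` at
`K = K₀ ± excessSlope η · ε`). [folklore] -/
theorem uniformlyIntegrable_of_klDiv_flip_le
    (hinv : μ₀.map (fun x : PhaseSpace N => (x.1, -x.2)) = μ₀) {K₀ : ℝ} (hK₀ : 0 ≤ K₀)
    (φ : ℝ → PhaseSpace N → ℝ) (hφm : ∀ δ, Measurable (φ δ))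
    (hZ : ∀ᶠ δ in 𝓝[≠] (0 : ℝ), Integrable (fun x => exp (φ δ x)) μ₀ ∧ ∫ x, exp (φ δ x) ∂μ₀ = 1)
    (hKL : ∀ K : ℝ, K₀ < K → ∀ᶠ δ in 𝓝[≠] (0 : ℝ),
      klDiv (μ₀.tilted (φ δ)) ((μ₀.tilted (φ δ)).map (fun x : PhaseSpace N => (x.1, -x.2))) ≤
        ENNReal.ofReal (K * δ ^ 2))
    (hΔlow : ∀ K : ℝ, K < K₀ → ∀ᶠ δ in 𝓝[≠] (0 : ℝ),
      K * δ ^ 2 ≤ ∫ x, (exp (φ δ x) - exp (φ δ (x.1, -x.2))) ^ 2 /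
        (exp (φ δ x) + exp (φ δ (x.1, -x.2))) ∂μ₀) :
    ∀ η : ℝ, 0 < η → ∀ ε : ℝ, 0 < ε → ∀ᶠ δ in 𝓝[≠] (0 : ℝ),
      Integrable (fun x => |φ δ x - φ δ (x.1, -x.2)| * exp (φ δ x)) μ₀ ∧
      ∫ x in {x | η < |φ δ x - φ δ (x.1, -x.2)|}, |φ δ x - φ δ (x.1, -x.2)| * exp (φ δ x) ∂μ₀ ≤
        ε * δ ^ 2 := by
  intro η hη ε hε
  have hθ0 : 0 < excessSlope η * ε := mul_pos (excessSlope_pos hη) hε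
  filter_upwards [hZ, hKL (K₀ + excessSlope η * ε) (by linarith),
    hΔlow (K₀ - excessSlope η * ε) (by linarith)] with δ hZδ hKδ hΔδ
  exact setIntegral_abs_mul_exp_le_of_klDiv_le μ₀ hinv (hφm δ) hZδ.1 hZδ.2 hη hε hK₀ (sq_nonneg δ)
    hKδ hΔδ

end Seam

end Summit.AtomisticToContinuum.FouriersLaw.Theorems.ExtensiveSnapshotIrreversibility.EnergyWindow

end
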